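import Mathlib
import HarnessLib
import Literature.Analysis.FluidPDE.PineauVicolAngularMean
import Literature.Analysis.FluidPDE.NSLocalLerayBackwardUniqueness
import Summits.NavierStokesRegularity.NavierStokesRegularity.Theorems.PoloidalWindowDoorPoloidalWindowRigidityOneSlice
import Summits.NavierStokesRegularity.NavierStokesRegularity.Theorems.PoloidalWindowDoorPoloidalWindowRigidityVorticityTranslate

/-!
# K2 `PoloidalWindowRigidity` (stmt-NavierStokesRegularity-19708) — GERMS OF SYMMETRY AND OF DEGENERACY ON ONE SLICE
# ARE GLOBAL: the analytic glue of the (R) «finite type» endgame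

Cell ns-regularity-ideate, seat nsreg-p7 gen 7 (third worker under the K2 lead ns-poloidal-K2-p1).  The lead's
K2P1-LOCAL-NOTES v1 (2026-08-27, RESULT-vs-PREREG of LEAD LINE #1 (3)) leaves the residue S2⁗ UNDECIDED between
(F) functional freedom and (R) finite type; under (R) «K2 follows from analyticity of mild solutions + the settled
strata + H4b∞ + the degenerate sets {ω = 0}, {Λ ∈ {0,1}}», i.e. from statements of the form «if the jet of ONE slice
at ONE point lies in an exceptional family, the profile is trivial».  This file supplies those statements for every
exceptional family that is a settled stratum, in the germ form a certificate produces: a condition holding on a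
NONEMPTY OPEN SET of ONE slice.  Spatial real-analyticity of the slices (tree `analyticOnNhd_slice`) spreads the germ
to the whole slice (identity theorem), and the one-slice stratum theorems of the programme conclude.

* `isAxisymmetric_of_rotDefect_eq_zero` — pure geometry: a `C¹` field `V` on `ℝ³` whose ROTATIONAL DEFECT
  `𝓡V(x) := J V(x) − DV(x)(J x)` (`J = rotGen`, the Killing field of rotations about the vertical axis) vanishes
  identically is axisymmetric, `V(R_θ x) = R_θ V(x)` (integrate `d/dθ [R_{−θ} V(R_θ y)] = −R_{−θ}(𝓡V)(R_θ y)`, tree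
  `hasDerivAt_rotZ_neg_comp_rotZ`).
* `rotDefect_eq_zero_of_eqOn_open` — for real-analytic `V`: `𝓡V = 0` on a nonempty open set ⇒ `𝓡V ≡ 0`.
* `eq_zero_of_rotDefect_eq_zero_on_open` — CLASS: a profile poloidal along `e₃` on every slice whose rotational
  defect about some vertical axis `c + ℝe₃` vanishes on a nonempty open set of ONE slice is `≡ 0`
  (the slice is axisymmetric about that axis ⇒ tree `eq_zero_of_axisymmetric_slice`, KNSS Thm 5.2).
* `eq_zero_of_fderiv_apply_eq_zero_on_open` — a translation germ: `∂_e v(s) = 0` on a nonempty open set of one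
  slice, `e ≠ 0` ⇒ `v ≡ 0` (identity theorem ⇒ slice invariant along `e` ⇒ tree `eq_zero_of_translate_eq_slice`).
* `eq_zero_of_curl_eq_zero_on_open` — the degenerate set `{ω = 0}`: `curl v(s) = 0` on a nonempty open set of one
  slice ⇒ `v ≡ 0` (tree `curl_eq_zero_of_eqOn_open` + `eq_zero_of_curl_translate_eq_slice`).
* `eq_zero_of_horizontalGradient_eq_zero_on_open` — the degenerate slope `Λ = 0`: on one poloidal slice,
  `∂₀(v·e₃) = 0` on a nonempty open set ⇒ `v ≡ 0` (identity theorem ⇒ flat slice ⇒ tree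
  `eq_zero_of_flat_slice_single_zero`).
* `eq_zero_of_shearRatio_one_on_open` — the degenerate slope `Λ = ∞` (shear ratio `μ = 1`, `∂₂v_h = ∇_h v₂`): on
  one poloidal slice this says `ω = 0` on the open set, so `eq_zero_of_curl_eq_zero_on_open` applies.

(The slope `Λ = 1` — `μ = 0`, `∂₂v_h = 0` on an open set — and the constant-slope family H4b∞ are the stub-worker
ns-poloidal-K2-p2's lane and are not treated here.)

WHAT THIS IS NOT: not a claim about Navier–Stokes regularity and not the crux; no jet certificate is claimed — these
are the analytic-continuation lemmas such a certificate would be composed with (bears_on LADDER-NS N0, route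
PoloidalWindowDoor, crux K2; `--supports` the K2 item).
-/

noncomputable section

-- the summit and its single sub-problem share the name (CONVENTIONS §1), as in every Theorems file
set_option linter.dupNamespace false

namespace Summit.NavierStokesRegularity.NavierStokesRegularity.Theorems.PoloidalWindowDoorPoloidalWindowRigiditySymmetryGerms

open MeasureTheory Set Function Filter Topology Metric InnerProductSpace
open scoped RealInnerProductSpace
open Literature.Analysis Literature.Analysis.FluidPDE
open Summit.NavierStokesRegularity.NavierStokesRegularity.Theorems.LocalSineTubeDoorProfileAlignedWindowRigidityAncient
open Summit.NavierStokesRegularity.NavierStokesRegularity.Theorems.PoloidalWindowDoorPoloidalWindowRigidityOneSlice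
open Summit.NavierStokesRegularity.NavierStokesRegularity.Theorems.PoloidalWindowDoorPoloidalWindowRigidityVorticityTranslate

variable {C : ℝ} {v : ℝ → EuclideanSpace ℝ (Fin 3) → EuclideanSpace ℝ (Fin 3)}

/-! ### analytic spreading of a vector identity from an open set -/

/-- Identity theorem, packaged: two real-analytic maps on `ℝ³` that agree on a nonempty open set agree everywhere. -/
theorem eq_of_eqOn_open {F : Type*} [NormedAddCommGroup F] [NormedSpace ℝ F]
    {f g : EuclideanSpace ℝ (Fin 3) → F} (hf : AnalyticOnNhd ℝ f univ) (hg : AnalyticOnNhd ℝ g univ)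
    {U : Set (EuclideanSpace ℝ (Fin 3))} (hU : IsOpen U) (hne : U.Nonempty) (h : ∀ x ∈ U, f x = g x)
    (x : EuclideanSpace ℝ (Fin 3)) : f x = g x := by
  obtain ⟨x₀, hx₀⟩ := hne
  have hev : f =ᶠ[𝓝 x₀] g := Filter.eventually_of_mem (hU.mem_nhds hx₀) h
  exact congrFun (hf.eq_of_eventuallyEq hg hev) x

/-- `x ↦ Df(x) w(x)` is real-analytic for real-analytic `f` and `w` (evaluation is bilinear). -/
theorem analyticOnNhd_fderiv_apply {F : Type*} [NormedAddCommGroup F] [NormedSpace ℝ F] [CompleteSpace F]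
    {f : EuclideanSpace ℝ (Fin 3) → F} (hf : AnalyticOnNhd ℝ f univ)
    {w : EuclideanSpace ℝ (Fin 3) → EuclideanSpace ℝ (Fin 3)} (hw : AnalyticOnNhd ℝ w univ) :
    AnalyticOnNhd ℝ (fun x => fderiv ℝ f x (w x)) univ := by
  have hev : AnalyticOnNhd ℝ (fun p : EuclideanSpace ℝ (Fin 3) × (EuclideanSpace ℝ (Fin 3) →L[ℝ] F) =>
      (ContinuousLinearMap.apply ℝ F) p.1 p.2) univ := fun p _ =>
    (ContinuousLinearMap.apply ℝ F).analyticAt_bilinear p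
  have h := hev.comp₂ hw hf.fderiv (fun x _ => mem_univ _)
  have e : (fun x => fderiv ℝ f x (w x)) =
      fun x => (ContinuousLinearMap.apply ℝ F) (w x) (fderiv ℝ f x) := by
    funext x; rw [ContinuousLinearMap.apply_apply]
  rw [e]; exact h

/-- The generator `J = rotGen` is real-analytic (it is linear). -/
theorem analyticOnNhd_rotGen : AnalyticOnNhd ℝ (fun x : EuclideanSpace ℝ (Fin 3) => rotGen x) univ :=
  fun x _ => (rotGenL.analyticAt x).congr (Eventually.of_forall fun z => rotGenL_apply z)

/-! ### rotational germs: zero rotational defect is axisymmetry -/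

/-- **Zero rotational defect ⇒ axisymmetric.**  A `C¹` field `V` on `ℝ³` with `J V(x) = DV(x)(J x)` for every `x`
(`J = rotGen`; the Lie derivative of `V` along the rotation Killing field vanishes) is axisymmetric:
`V(R_θ x) = R_θ V(x)` for all `θ`, `x`. -/
theorem isAxisymmetric_of_rotDefect_eq_zero {V : EuclideanSpace ℝ (Fin 3) → EuclideanSpace ℝ (Fin 3)}
    (hV : ContDiff ℝ 1 V) (h : ∀ x, rotGen (V x) = fderiv ℝ V x (rotGen x)) : IsAxisymmetric V := by
  intro θ y
  -- `g t = R_{−t} V(R_t y)` has zero derivative, hence is constant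
  set g : ℝ → EuclideanSpace ℝ (Fin 3) := fun t => rotZ (-t) (V (rotZ t y)) with hg
  have hd : ∀ t, HasDerivAt g 0 t := by
    intro t
    have h1 := hasDerivAt_rotZ_neg_comp_rotZ hV y t
    have h0 : -(rotZ (-t) (rotGen (V (rotZ t y)) - fderiv ℝ V (rotZ t y) (rotGen (rotZ t y)))) = 0 := by
      rw [h (rotZ t y), sub_self, show rotZ (-t) (0 : EuclideanSpace ℝ (Fin 3)) = 0 by
        simpa using map_zero (rotZL (-t)), neg_zero]
    rw [h0] at h1
    exact h1
  have hdiff : Differentiable ℝ g := fun t => (hd t).differentiableAt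
  have hconst := is_const_of_deriv_eq_zero hdiff (fun t => (hd t).deriv) θ 0
  simp only [hg, neg_zero, rotZ_zero] at hconst
  -- `R_{−θ} V(R_θ y) = V y` ⇒ `V(R_θ y) = R_θ V(y)`
  have h2 := congrArg (rotZ θ) hconst
  rwa [← rotZ_add, add_neg_cancel, rotZ_zero] at h2

/-- **A germ of vanishing rotational defect spreads** (identity theorem): for a real-analytic field `V` on `ℝ³`, if
`J V(x) = DV(x)(J x)` on a nonempty open set then everywhere. -/
theorem rotDefect_eq_zero_of_eqOn_open {V : EuclideanSpace ℝ (Fin 3) → EuclideanSpace ℝ (Fin 3)}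
    (hV : AnalyticOnNhd ℝ V univ) {U : Set (EuclideanSpace ℝ (Fin 3))} (hU : IsOpen U) (hne : U.Nonempty)
    (h : ∀ x ∈ U, rotGen (V x) = fderiv ℝ V x (rotGen x)) (x : EuclideanSpace ℝ (Fin 3)) :
    rotGen (V x) = fderiv ℝ V x (rotGen x) := by
  have hJV : AnalyticOnNhd ℝ (fun x => rotGen (V x)) univ := fun x _ =>
    ((rotGenL.analyticAt (V x)).comp (hV x (mem_univ x))).congr (Eventually.of_forall fun z => rotGenL_apply _)
  have hDV : AnalyticOnNhd ℝ (fun x => fderiv ℝ V x (rotGen x)) univ :=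
    analyticOnNhd_fderiv_apply hV analyticOnNhd_rotGen
  exact eq_of_eqOn_open hJV hDV hU hne h x

/-- **CLASS: a rotational germ on ONE slice kills the profile.**  Let `v` be a profile of the route's Type-I class,
poloidal along `e₃` on every slice.  If on ONE slice `s < 0` the rotational defect about the vertical axis through `c`
vanishes on a nonempty open set, `J v(s,y) = Dv(s)(y)(J(y − c))` for `y ∈ U`, then `v ≡ 0`: the slice is axisymmetric
about `c + ℝe₃` (`isAxisymmetric_of_rotDefect_eq_zero` after analytic spreading) and the tree's one-slice axisymmetric
stratum theorem `eq_zero_of_axisymmetric_slice` (KNSS 2009 Thm 5.2) applies. -/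
theorem eq_zero_of_rotDefect_eq_zero_on_open (hrate : HasTypeITimeDecay C v)
    (hcont : ContinuousOn (uncurry v) (Iio (0 : ℝ) ×ˢ univ))
    (hmild : ∀ s t : ℝ, s < t → t < 0 → ∀ x,
      v t x = UnboundedOperators.heatExtension (v s) (t - s) x - oseenDuhamel 1 s v v t x)
    (hdiv : ∀ t < 0, VectorCalculus.IsDivFree (v t))
    (hpol : ∀ s < 0, ∀ y, ⟪curl (v s) y, EuclideanSpace.single 2 1⟫_ℝ = 0)
    (c : EuclideanSpace ℝ (Fin 3)) {s : ℝ} (hs : s < 0) {U : Set (EuclideanSpace ℝ (Fin 3))} (hU : IsOpen U)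
    (hne : U.Nonempty) (h : ∀ y ∈ U, rotGen (v s y) = fderiv ℝ (v s) y (rotGen (y - c))) :
    ∀ t < 0, ∀ x, v t x = 0 := by
  have hbdd := bdd_of_hasTypeITimeDecay hrate
  have hA : AnalyticOnNhd ℝ (v s) univ := analyticOnNhd_slice hcont hbdd hmild hs
  -- the translated slice `V y = v(s, y + c)`
  set V : EuclideanSpace ℝ (Fin 3) → EuclideanSpace ℝ (Fin 3) := fun y => v s (y + c) with hVdef
  have hτ : AnalyticOnNhd ℝ (fun y : EuclideanSpace ℝ (Fin 3) => y + c) univ := fun y _ =>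
    analyticAt_id.add analyticAt_const
  have hVA : AnalyticOnNhd ℝ V univ := hA.comp hτ (fun _ _ => mem_univ _)
  have hV1 : ContDiff ℝ 1 V := hVA.contDiff
  have hDVy : ∀ y, fderiv ℝ V y = fderiv ℝ (v s) (y + c) := fun y => by
    simp only [hVdef]
    exact fderiv_comp_add_right (𝕜 := ℝ) (f := v s) (x := y) c
  -- the germ on `U − c`
  have hU' : IsOpen ((fun y : EuclideanSpace ℝ (Fin 3) => y + c) ⁻¹' U) :=
    hU.preimage (continuous_id.add continuous_const)
  have hne' : ((fun y : EuclideanSpace ℝ (Fin 3) => y + c) ⁻¹' U).Nonempty := by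
    obtain ⟨u, hu⟩ := hne
    exact ⟨u - c, by simpa using hu⟩
  have hgerm : ∀ y ∈ (fun y : EuclideanSpace ℝ (Fin 3) => y + c) ⁻¹' U,
      rotGen (V y) = fderiv ℝ V y (rotGen y) := by
    intro y hy
    rw [hDVy y, hVdef]
    have h1 := h (y + c) hy
    rwa [add_sub_cancel_right] at h1
  have hall := rotDefect_eq_zero_of_eqOn_open hVA hU' hne' hgerm
  have haxi : IsAxisymmetric V := isAxisymmetric_of_rotDefect_eq_zero hV1 hall
  exact eq_zero_of_axisymmetric_slice hrate hcont hmild hdiv hpol c hs haxi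

/-! ### translation germs -/

/-- A `C¹` field whose derivative along `e` vanishes identically is invariant under the translations along `e`. -/
theorem translate_eq_of_fderiv_apply_eq_zero {V : EuclideanSpace ℝ (Fin 3) → EuclideanSpace ℝ (Fin 3)}
    (hV : Differentiable ℝ V) {e : EuclideanSpace ℝ (Fin 3)} (h : ∀ y, fderiv ℝ V y e = 0)
    (y : EuclideanSpace ℝ (Fin 3)) (l : ℝ) : V (y + l • e) = V y := by
  set g : ℝ → EuclideanSpace ℝ (Fin 3) := fun l => V (y + l • e) with hg
  have hline : ∀ l : ℝ, HasDerivAt (fun l : ℝ => y + l • e) e l := fun l => by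
    simpa using ((hasDerivAt_id l).smul_const e).const_add y
  have hd : ∀ l, HasDerivAt g 0 l := by
    intro l
    have h1 := (hV (y + l • e)).hasFDerivAt.comp_hasDerivAt l (hline l)
    rw [h (y + l • e)] at h1
    exact h1
  have hdiff : Differentiable ℝ g := fun l => (hd l).differentiableAt
  have hconst := is_const_of_deriv_eq_zero hdiff (fun l => (hd l).deriv) l 0
  simpa [hg] using hconst

/-- **CLASS: a translation germ on ONE slice kills the profile.**  If on one slice `s < 0` of a profile of the route's
Type-I class the directional derivative `∂_e v(s)` vanishes on a nonempty open set (`e ≠ 0`), then `v ≡ 0`: by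
analyticity `∂_e v(s) ≡ 0`, so the slice is invariant under the translations along `e`, and the tree's one-slice
planar Liouville theorem `eq_zero_of_translate_eq_slice` applies. -/
theorem eq_zero_of_fderiv_apply_eq_zero_on_open (hrate : HasTypeITimeDecay C v)
    (hcont : ContinuousOn (uncurry v) (Iio (0 : ℝ) ×ˢ univ))
    (hmild : ∀ s t : ℝ, s < t → t < 0 → ∀ x,
      v t x = UnboundedOperators.heatExtension (v s) (t - s) x - oseenDuhamel 1 s v v t x)
    (hdiv : ∀ t < 0, VectorCalculus.IsDivFree (v t)) {s : ℝ} (hs : s < 0)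
    {e : EuclideanSpace ℝ (Fin 3)} (he : e ≠ 0) {U : Set (EuclideanSpace ℝ (Fin 3))} (hU : IsOpen U)
    (hne : U.Nonempty) (h : ∀ y ∈ U, fderiv ℝ (v s) y e = 0) : ∀ t < 0, ∀ x, v t x = 0 := by
  have hbdd := bdd_of_hasTypeITimeDecay hrate
  have hA : AnalyticOnNhd ℝ (v s) univ := analyticOnNhd_slice hcont hbdd hmild hs
  have hDe : AnalyticOnNhd ℝ (fun y => fderiv ℝ (v s) y e) univ :=
    analyticOnNhd_fderiv_apply hA (fun y _ => analyticAt_const)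
  have hall : ∀ y, fderiv ℝ (v s) y e = 0 := fun y =>
    eq_of_eqOn_open hDe (fun y _ => analyticAt_const) hU hne h y
  have hd1 : Differentiable ℝ (v s) := (hA.contDiff (n := 1)).differentiable one_ne_zero
  have hinv : ∀ (y : EuclideanSpace ℝ (Fin 3)) (l : ℝ), v s (y + l • e) = v s y :=
    translate_eq_of_fderiv_apply_eq_zero hd1 hall
  exact eq_zero_of_translate_eq_slice hrate hcont hmild hdiv hs he hinv

/-! ### the degenerate set `{ω = 0}` -/

/-- **CLASS: an irrotational germ on ONE slice kills the profile.**  If `curl v(s) = 0` on a nonempty open set of one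
slice `s < 0` of a profile of the route's Type-I class, then `v ≡ 0`: the curl of the real-analytic slice vanishes
identically (tree `curl_eq_zero_of_eqOn_open`), so it is trivially translation-invariant, and the tree's stratum (A)
`eq_zero_of_curl_translate_eq_slice` applies.  No poloidality is needed. -/
theorem eq_zero_of_curl_eq_zero_on_open (hrate : HasTypeITimeDecay C v)
    (hcont : ContinuousOn (uncurry v) (Iio (0 : ℝ) ×ˢ univ))
    (hmild : ∀ s t : ℝ, s < t → t < 0 → ∀ x,
      v t x = UnboundedOperators.heatExtension (v s) (t - s) x - oseenDuhamel 1 s v v t x)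
    (hdiv : ∀ t < 0, VectorCalculus.IsDivFree (v t)) {s : ℝ} (hs : s < 0)
    {U : Set (EuclideanSpace ℝ (Fin 3))} (hU : IsOpen U) (hne : U.Nonempty) (h : ∀ y ∈ U, curl (v s) y = 0) :
    ∀ t < 0, ∀ x, v t x = 0 := by
  have hbdd := bdd_of_hasTypeITimeDecay hrate
  have hA : AnalyticOnNhd ℝ (v s) univ := analyticOnNhd_slice hcont hbdd hmild hs
  have hall : ∀ y, curl (v s) y = 0 := curl_eq_zero_of_eqOn_open hA hU hne h
  have hne0 : (EuclideanSpace.single 0 1 : EuclideanSpace ℝ (Fin 3)) ≠ 0 := fun h0 => by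
    simpa using congrArg (fun w : EuclideanSpace ℝ (Fin 3) => w 0) h0
  refine eq_zero_of_curl_translate_eq_slice hrate hcont hmild hdiv hs hne0 fun y l => ?_
  rw [hall, hall]

/-! ### the degenerate slope `Λ = 0`: a flat germ -/

/-- **CLASS: a flat germ on ONE poloidal slice kills the profile.**  If one slice `s < 0` of a profile of the route's
Type-I class is poloidal along `e₃` and `∂₀(v·e₃)` vanishes on a nonempty open set of it, then `v ≡ 0`: by analyticity
`∂₀(v·e₃) ≡ 0` on the slice (the slice is flat along `e₀`), and the tree's one-slice flat stratum theorem
`eq_zero_of_flat_slice_single_zero` applies.  (The degenerate Clebsch slope `Λ = 0`, i.e. `∇_h(v·e₃) = 0`, is the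
case where also `∂₁(v·e₃)` vanishes.) -/
theorem eq_zero_of_horizontalGradient_eq_zero_on_open (hrate : HasTypeITimeDecay C v)
    (hcont : ContinuousOn (uncurry v) (Iio (0 : ℝ) ×ˢ univ))
    (hmild : ∀ s t : ℝ, s < t → t < 0 → ∀ x,
      v t x = UnboundedOperators.heatExtension (v s) (t - s) x - oseenDuhamel 1 s v v t x)
    (hdiv : ∀ t < 0, VectorCalculus.IsDivFree (v t)) {s : ℝ} (hs : s < 0)
    (hpol : ∀ y, ⟪curl (v s) y, EuclideanSpace.single 2 1⟫_ℝ = 0)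
    {U : Set (EuclideanSpace ℝ (Fin 3))} (hU : IsOpen U) (hne : U.Nonempty)
    (h : ∀ y ∈ U, fderiv ℝ (v s) y (EuclideanSpace.single 0 1) 2 = 0) : ∀ t < 0, ∀ x, v t x = 0 := by
  have hbdd := bdd_of_hasTypeITimeDecay hrate
  have hA : AnalyticOnNhd ℝ (v s) univ := analyticOnNhd_slice hcont hbdd hmild hs
  have hD0 : AnalyticOnNhd ℝ (fun y => fderiv ℝ (v s) y (EuclideanSpace.single 0 1)) univ :=
    analyticOnNhd_fderiv_apply hA (fun y _ => analyticAt_const)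
  have hD02 : AnalyticOnNhd ℝ (fun y => fderiv ℝ (v s) y (EuclideanSpace.single 0 1) 2) univ := fun y _ =>
    ((EuclideanSpace.proj (𝕜 := ℝ) (2 : Fin 3)).analyticAt _).comp (hD0 y (mem_univ y))
  have hall : ∀ y, fderiv ℝ (v s) y (EuclideanSpace.single 0 1) 2 = 0 := fun y =>
    eq_of_eqOn_open hD02 (fun y _ => analyticAt_const) hU hne h y
  exact eq_zero_of_flat_slice_single_zero hrate hcont hmild hdiv hs hpol hall

/-! ### the degenerate slope `Λ = ∞`: shear ratio one -/

/-- **CLASS: a germ of shear ratio `μ = 1` on ONE poloidal slice kills the profile.**  If one slice `s < 0` is poloidal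
along `e₃` and on a nonempty open set the vertical shear equals the horizontal gradient of the vertical velocity,
`∂₂v_b = ∂_b v₂` (`b = 0, 1`; the degenerate Clebsch slope `Λ = ∞`), then the horizontal vorticity vanishes there
too, the germ is irrotational, and `eq_zero_of_curl_eq_zero_on_open` concludes `v ≡ 0`. -/
theorem eq_zero_of_shearRatio_one_on_open (hrate : HasTypeITimeDecay C v)
    (hcont : ContinuousOn (uncurry v) (Iio (0 : ℝ) ×ˢ univ))
    (hmild : ∀ s t : ℝ, s < t → t < 0 → ∀ x,
      v t x = UnboundedOperators.heatExtension (v s) (t - s) x - oseenDuhamel 1 s v v t x)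
    (hdiv : ∀ t < 0, VectorCalculus.IsDivFree (v t)) {s : ℝ} (hs : s < 0)
    (hpol : ∀ y, ⟪curl (v s) y, EuclideanSpace.single 2 1⟫_ℝ = 0)
    {U : Set (EuclideanSpace ℝ (Fin 3))} (hU : IsOpen U) (hne : U.Nonempty)
    (h : ∀ y ∈ U, fderiv ℝ (v s) y (EuclideanSpace.single 2 1) 0 = fderiv ℝ (v s) y (EuclideanSpace.single 0 1) 2 ∧
      fderiv ℝ (v s) y (EuclideanSpace.single 2 1) 1 = fderiv ℝ (v s) y (EuclideanSpace.single 1 1) 2) :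
    ∀ t < 0, ∀ x, v t x = 0 := by
  refine eq_zero_of_curl_eq_zero_on_open hrate hcont hmild hdiv hs hU hne fun y hy => ?_
  have h2 : curl (v s) y 2 = 0 := by
    have hp := hpol y
    rwa [EuclideanSpace.inner_single_right, one_mul, conj_trivial] at hp
  obtain ⟨h0, h1⟩ := h y hy
  ext i
  fin_cases i
  · simp [curl, h1]
  · simp [curl, h0]
  · simpa using h2

end Summit.NavierStokesRegularity.NavierStokesRegularity.Theorems.PoloidalWindowDoorPoloidalWindowRigiditySymmetryGerms

end
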